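import Mathlib
import Summits.Ventures.PercRepro.TriangleCapRegularCellNine

/-!
# PercRepro — THE REGULAR CELL `t = 11 D`: THE COUNTS AND THE GAPS (p3, gen 57)

The counts `n_j` of the rows of size `j` at `ℓ = 11` and the gaps of the excess set: each gap `g` is excluded by the
pair solutions of `Σ_k k (11 − k) p_k = 2 g` (`_pairs`) and the counts mod `11` (`_arith`).  Axioms: standard.
-/

namespace PercRepro

namespace TriangleCap

namespace C047

open Finset

/-- The entries of a list in `[1, 11]` give a sequence in `[1, 11]` below the length. -/
theorem getD_bounds_eleven (L : List ℕ) (hL : ∀ x ∈ L, 1 ≤ x ∧ x ≤ 11) (i : ℕ) (hi : i < L.length) :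
    1 ≤ L.getD i 0 ∧ L.getD i 0 ≤ 11 := by
  rw [List.getD_eq_getElem L 0 hi]
  exact hL _ (List.getElem_mem hi)

/-- A sum of a function of the row sizes is the sum over the sizes `j ≤ 11` of `n_j · f(j)`. -/
theorem sum_rows_eq_sum_counts_eleven (k : ℕ → ℕ) (N : ℕ) (hk : ∀ i, i < N → k i ≤ 11) (f : ℕ → ℕ) :
    ∑ i ∈ range N, f (k i) = ∑ j ∈ range 12, ((range N).filter (fun i => k i = j)).card * f j := by
  rw [← sum_fiberwise_of_maps_to (s := range N) (t := range 12) (g := k) (fun i hi => by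
    rw [mem_range] at hi ⊢
    have := hk i hi
    omega)]
  apply sum_congr rfl
  intro j _
  rw [card_eq_sum_ones, sum_mul, one_mul]
  apply sum_congr rfl
  intro i hi
  rw [mem_filter] at hi
  rw [hi.2]

/-- The row counts at `ℓ = 11`. -/
theorem counts_eleven (k : ℕ → ℕ) (N : ℕ) (hk : ∀ i, i < N → 1 ≤ k i ∧ k i ≤ 11) :
    ∑ i ∈ range N, k i = ((range N).filter (fun i => k i = 1)).card +
      2 * ((range N).filter (fun i => k i = 2)).card +
      3 * ((range N).filter (fun i => k i = 3)).card +
      4 * ((range N).filter (fun i => k i = 4)).card +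
      5 * ((range N).filter (fun i => k i = 5)).card +
      6 * ((range N).filter (fun i => k i = 6)).card +
      7 * ((range N).filter (fun i => k i = 7)).card +
      8 * ((range N).filter (fun i => k i = 8)).card +
      9 * ((range N).filter (fun i => k i = 9)).card +
      10 * ((range N).filter (fun i => k i = 10)).card +
      11 * ((range N).filter (fun i => k i = 11)).card ∧
    ∑ i ∈ range N, k i * (11 - k i) = 10 * ((range N).filter (fun i => k i = 1)).card +
      18 * ((range N).filter (fun i => k i = 2)).card +
      24 * ((range N).filter (fun i => k i = 3)).card +
      28 * ((range N).filter (fun i => k i = 4)).card +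
      30 * ((range N).filter (fun i => k i = 5)).card +
      30 * ((range N).filter (fun i => k i = 6)).card +
      28 * ((range N).filter (fun i => k i = 7)).card +
      24 * ((range N).filter (fun i => k i = 8)).card +
      18 * ((range N).filter (fun i => k i = 9)).card +
      10 * ((range N).filter (fun i => k i = 10)).card := by
  have h1 := sum_rows_eq_sum_counts_eleven k N (fun i hi => (hk i hi).2) (fun j => j)
  have h2 := sum_rows_eq_sum_counts_eleven k N (fun i hi => (hk i hi).2) (fun j => j * (11 - j))
  simp only [sum_range_succ, sum_range_zero] at h1 h2
  norm_num at h1 h2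
  constructor
  · rw [h1]; ring
  · rw [h2]; ring

/-- The pair solutions of `10 * p1 + 18 * p2 + 24 * p3 + 28 * p4 + 30 * p5 = 42`. -/
theorem no_twentyone_eleven_pairs (p1 p2 p3 p4 p5 : ℕ) (h : 10 * p1 + 18 * p2 + 24 * p3 + 28 * p4 + 30 * p5 = 42) :
    (p1 = 0 ∧ p2 = 1 ∧ p3 = 1 ∧ p4 = 0 ∧ p5 = 0) := by
  have hb2 : p2 ≤ 2 := by omega
  have hb3 : p3 ≤ 1 := by omega
  have hb4 : p4 ≤ 1 := by omega
  have hb5 : p5 ≤ 1 := by omega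
  interval_cases p2 <;> interval_cases p3 <;> interval_cases p4 <;> interval_cases p5 <;> omega

/-- The gap `21` at `ℓ = 11` in the counts: `Σ_k k n_k = 11 D` and `Σ_k k (11 − k) n_k = 42` are incompatible. -/
theorem no_twentyone_eleven_arith (n1 n2 n3 n4 n5 n6 n7 n8 n9 n10 n11 D : ℕ) (hsum : n1 + 2 * n2 + 3 * n3 + 4 * n4 + 5 * n5 + 6 * n6 + 7 * n7 + 8 * n8 + 9 * n9 + 10 * n10 + 11 * n11 = 11 * D) (hv : 10 * n1 + 18 * n2 + 24 * n3 + 28 * n4 + 30 * n5 + 30 * n6 + 28 * n7 + 24 * n8 + 18 * n9 + 10 * n10 = 42) : False := by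
  have hS : n1 + 2 * n2 + 3 * n3 + 4 * n4 + 5 * n5 + 6 * n6 + 7 * n7 + 8 * n8 + 9 * n9 + 10 * n10 = 11 * (D - n11) := by omega
  have hmod : (n1 + 2 * n2 + 3 * n3 + 4 * n4 + 5 * n5 + 6 * n6 + 7 * n7 + 8 * n8 + 9 * n9 + 10 * n10) % 11 = 0 := by
    rw [hS, Nat.mul_mod_right]
  clear hsum hS
  have hp := no_twentyone_eleven_pairs (n1 + n10) (n2 + n9) (n3 + n8) (n4 + n7) (n5 + n6) (by omega)
  clear hv
  rcases hp with ⟨hp1, hp2, hp3, hp4, hp5⟩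
  · have hz : n1 = 0 ∧ n10 = 0 ∧ n4 = 0 ∧ n7 = 0 ∧ n5 = 0 ∧ n6 = 0 := by omega
    obtain ⟨rfl, rfl, rfl, rfl, rfl, rfl⟩ := hz
    simp only [mul_zero, add_zero] at hmod
    have hb9 : n9 ≤ 1 := by omega
    have hb8 : n8 ≤ 1 := by omega
    interval_cases n9 <;> interval_cases n8 <;> omega

/-- **THE GAP `21` AT `ℓ = 11`:** `Σ k (11 − k) ≠ 42` when `Σ k = 11 D`. -/
theorem no_twentyone_eleven (D : ℕ) (k : ℕ → ℕ) (N : ℕ) (hk : ∀ i, i < N → 1 ≤ k i ∧ k i ≤ 11)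
    (hsum : ∑ i ∈ range N, k i = 11 * D) : ∑ i ∈ range N, k i * (11 - k i) ≠ 42 := by
  intro hv
  obtain ⟨h1, h2⟩ := counts_eleven k N hk
  rw [h1] at hsum
  rw [h2] at hv
  exact no_twentyone_eleven_arith _ _ _ _ _ _ _ _ _ _ _ D hsum hv

/-- The pair solutions of `10 * p1 + 18 * p2 + 24 * p3 + 28 * p4 + 30 * p5 = 44`. -/
theorem no_twentytwo_eleven_pairs (p1 p2 p3 p4 p5 : ℕ) (h : 10 * p1 + 18 * p2 + 24 * p3 + 28 * p4 + 30 * p5 = 44) :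
    (p1 = 2 ∧ p2 = 0 ∧ p3 = 1 ∧ p4 = 0 ∧ p5 = 0) := by
  have hb2 : p2 ≤ 2 := by omega
  have hb3 : p3 ≤ 1 := by omega
  have hb4 : p4 ≤ 1 := by omega
  have hb5 : p5 ≤ 1 := by omega
  interval_cases p2 <;> interval_cases p3 <;> interval_cases p4 <;> interval_cases p5 <;> omega

/-- The gap `22` at `ℓ = 11` in the counts: `Σ_k k n_k = 11 D` and `Σ_k k (11 − k) n_k = 44` are incompatible. -/
theorem no_twentytwo_eleven_arith (n1 n2 n3 n4 n5 n6 n7 n8 n9 n10 n11 D : ℕ) (hsum : n1 + 2 * n2 + 3 * n3 + 4 * n4 + 5 * n5 + 6 * n6 + 7 * n7 + 8 * n8 + 9 * n9 + 10 * n10 + 11 * n11 = 11 * D) (hv : 10 * n1 + 18 * n2 + 24 * n3 + 28 * n4 + 30 * n5 + 30 * n6 + 28 * n7 + 24 * n8 + 18 * n9 + 10 * n10 = 44) : False := by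
  have hS : n1 + 2 * n2 + 3 * n3 + 4 * n4 + 5 * n5 + 6 * n6 + 7 * n7 + 8 * n8 + 9 * n9 + 10 * n10 = 11 * (D - n11) := by omega
  have hmod : (n1 + 2 * n2 + 3 * n3 + 4 * n4 + 5 * n5 + 6 * n6 + 7 * n7 + 8 * n8 + 9 * n9 + 10 * n10) % 11 = 0 := by
    rw [hS, Nat.mul_mod_right]
  clear hsum hS
  have hp := no_twentytwo_eleven_pairs (n1 + n10) (n2 + n9) (n3 + n8) (n4 + n7) (n5 + n6) (by omega)
  clear hv
  rcases hp with ⟨hp1, hp2, hp3, hp4, hp5⟩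
  · have hz : n2 = 0 ∧ n9 = 0 ∧ n4 = 0 ∧ n7 = 0 ∧ n5 = 0 ∧ n6 = 0 := by omega
    obtain ⟨rfl, rfl, rfl, rfl, rfl, rfl⟩ := hz
    simp only [mul_zero, add_zero] at hmod
    have hb10 : n10 ≤ 2 := by omega
    have hb8 : n8 ≤ 1 := by omega
    interval_cases n10 <;> interval_cases n8 <;> omega

/-- **THE GAP `22` AT `ℓ = 11`:** `Σ k (11 − k) ≠ 44` when `Σ k = 11 D`. -/
theorem no_twentytwo_eleven (D : ℕ) (k : ℕ → ℕ) (N : ℕ) (hk : ∀ i, i < N → 1 ≤ k i ∧ k i ≤ 11)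
    (hsum : ∑ i ∈ range N, k i = 11 * D) : ∑ i ∈ range N, k i * (11 - k i) ≠ 44 := by
  intro hv
  obtain ⟨h1, h2⟩ := counts_eleven k N hk
  rw [h1] at hsum
  rw [h2] at hv
  exact no_twentytwo_eleven_arith _ _ _ _ _ _ _ _ _ _ _ D hsum hv

/-- The pair solutions of `10 * p1 + 18 * p2 + 24 * p3 + 28 * p4 + 30 * p5 = 46`. -/
theorem no_twentythree_eleven_pairs (p1 p2 p3 p4 p5 : ℕ) (h : 10 * p1 + 18 * p2 + 24 * p3 + 28 * p4 + 30 * p5 = 46) :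
    (p1 = 0 ∧ p2 = 1 ∧ p3 = 0 ∧ p4 = 1 ∧ p5 = 0) ∨ (p1 = 1 ∧ p2 = 2 ∧ p3 = 0 ∧ p4 = 0 ∧ p5 = 0) := by
  have hb2 : p2 ≤ 2 := by omega
  have hb3 : p3 ≤ 1 := by omega
  have hb4 : p4 ≤ 1 := by omega
  have hb5 : p5 ≤ 1 := by omega
  interval_cases p2 <;> interval_cases p3 <;> interval_cases p4 <;> interval_cases p5 <;> omega

/-- The gap `23` at `ℓ = 11` in the counts: `Σ_k k n_k = 11 D` and `Σ_k k (11 − k) n_k = 46` are incompatible. -/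
theorem no_twentythree_eleven_arith (n1 n2 n3 n4 n5 n6 n7 n8 n9 n10 n11 D : ℕ) (hsum : n1 + 2 * n2 + 3 * n3 + 4 * n4 + 5 * n5 + 6 * n6 + 7 * n7 + 8 * n8 + 9 * n9 + 10 * n10 + 11 * n11 = 11 * D) (hv : 10 * n1 + 18 * n2 + 24 * n3 + 28 * n4 + 30 * n5 + 30 * n6 + 28 * n7 + 24 * n8 + 18 * n9 + 10 * n10 = 46) : False := by
  have hS : n1 + 2 * n2 + 3 * n3 + 4 * n4 + 5 * n5 + 6 * n6 + 7 * n7 + 8 * n8 + 9 * n9 + 10 * n10 = 11 * (D - n11) := by omega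
  have hmod : (n1 + 2 * n2 + 3 * n3 + 4 * n4 + 5 * n5 + 6 * n6 + 7 * n7 + 8 * n8 + 9 * n9 + 10 * n10) % 11 = 0 := by
    rw [hS, Nat.mul_mod_right]
  clear hsum hS
  have hp := no_twentythree_eleven_pairs (n1 + n10) (n2 + n9) (n3 + n8) (n4 + n7) (n5 + n6) (by omega)
  clear hv
  rcases hp with ⟨hp1, hp2, hp3, hp4, hp5⟩ | ⟨hp1, hp2, hp3, hp4, hp5⟩
  · have hz : n1 = 0 ∧ n10 = 0 ∧ n3 = 0 ∧ n8 = 0 ∧ n5 = 0 ∧ n6 = 0 := by omega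
    obtain ⟨rfl, rfl, rfl, rfl, rfl, rfl⟩ := hz
    simp only [mul_zero, add_zero] at hmod
    have hb9 : n9 ≤ 1 := by omega
    have hb7 : n7 ≤ 1 := by omega
    interval_cases n9 <;> interval_cases n7 <;> omega
  · have hz : n3 = 0 ∧ n8 = 0 ∧ n4 = 0 ∧ n7 = 0 ∧ n5 = 0 ∧ n6 = 0 := by omega
    obtain ⟨rfl, rfl, rfl, rfl, rfl, rfl⟩ := hz
    simp only [mul_zero, add_zero] at hmod
    have hb10 : n10 ≤ 1 := by omega
    have hb9 : n9 ≤ 2 := by omega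
    interval_cases n10 <;> interval_cases n9 <;> omega

/-- **THE GAP `23` AT `ℓ = 11`:** `Σ k (11 − k) ≠ 46` when `Σ k = 11 D`. -/
theorem no_twentythree_eleven (D : ℕ) (k : ℕ → ℕ) (N : ℕ) (hk : ∀ i, i < N → 1 ≤ k i ∧ k i ≤ 11)
    (hsum : ∑ i ∈ range N, k i = 11 * D) : ∑ i ∈ range N, k i * (11 - k i) ≠ 46 := by
  intro hv
  obtain ⟨h1, h2⟩ := counts_eleven k N hk
  rw [h1] at hsum
  rw [h2] at hv
  exact no_twentythree_eleven_arith _ _ _ _ _ _ _ _ _ _ _ D hsum hv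

/-- The pair solutions of `10 * p1 + 18 * p2 + 24 * p3 + 28 * p4 + 30 * p5 = 50`. -/
theorem no_twentyfive_eleven_pairs (p1 p2 p3 p4 p5 : ℕ) (h : 10 * p1 + 18 * p2 + 24 * p3 + 28 * p4 + 30 * p5 = 50) :
    (p1 = 2 ∧ p2 = 0 ∧ p3 = 0 ∧ p4 = 0 ∧ p5 = 1) ∨ (p1 = 5 ∧ p2 = 0 ∧ p3 = 0 ∧ p4 = 0 ∧ p5 = 0) := by
  have hb2 : p2 ≤ 2 := by omega
  have hb3 : p3 ≤ 2 := by omega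
  have hb4 : p4 ≤ 1 := by omega
  have hb5 : p5 ≤ 1 := by omega
  interval_cases p2 <;> interval_cases p3 <;> interval_cases p4 <;> interval_cases p5 <;> omega

/-- The gap `25` at `ℓ = 11` in the counts: `Σ_k k n_k = 11 D` and `Σ_k k (11 − k) n_k = 50` are incompatible. -/
theorem no_twentyfive_eleven_arith (n1 n2 n3 n4 n5 n6 n7 n8 n9 n10 n11 D : ℕ) (hsum : n1 + 2 * n2 + 3 * n3 + 4 * n4 + 5 * n5 + 6 * n6 + 7 * n7 + 8 * n8 + 9 * n9 + 10 * n10 + 11 * n11 = 11 * D) (hv : 10 * n1 + 18 * n2 + 24 * n3 + 28 * n4 + 30 * n5 + 30 * n6 + 28 * n7 + 24 * n8 + 18 * n9 + 10 * n10 = 50) : False := by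
  have hS : n1 + 2 * n2 + 3 * n3 + 4 * n4 + 5 * n5 + 6 * n6 + 7 * n7 + 8 * n8 + 9 * n9 + 10 * n10 = 11 * (D - n11) := by omega
  have hmod : (n1 + 2 * n2 + 3 * n3 + 4 * n4 + 5 * n5 + 6 * n6 + 7 * n7 + 8 * n8 + 9 * n9 + 10 * n10) % 11 = 0 := by
    rw [hS, Nat.mul_mod_right]
  clear hsum hS
  have hp := no_twentyfive_eleven_pairs (n1 + n10) (n2 + n9) (n3 + n8) (n4 + n7) (n5 + n6) (by omega)
  clear hv
  rcases hp with ⟨hp1, hp2, hp3, hp4, hp5⟩ | ⟨hp1, hp2, hp3, hp4, hp5⟩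
  · have hz : n2 = 0 ∧ n9 = 0 ∧ n3 = 0 ∧ n8 = 0 ∧ n4 = 0 ∧ n7 = 0 := by omega
    obtain ⟨rfl, rfl, rfl, rfl, rfl, rfl⟩ := hz
    simp only [mul_zero, add_zero] at hmod
    have hb10 : n10 ≤ 2 := by omega
    have hb6 : n6 ≤ 1 := by omega
    interval_cases n10 <;> interval_cases n6 <;> omega
  · have hz : n2 = 0 ∧ n9 = 0 ∧ n3 = 0 ∧ n8 = 0 ∧ n4 = 0 ∧ n7 = 0 ∧ n5 = 0 ∧ n6 = 0 := by omega
    obtain ⟨rfl, rfl, rfl, rfl, rfl, rfl, rfl, rfl⟩ := hz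
    simp only [mul_zero, add_zero] at hmod
    have hb10 : n10 ≤ 5 := by omega
    interval_cases n10 <;> omega

/-- **THE GAP `25` AT `ℓ = 11`:** `Σ k (11 − k) ≠ 50` when `Σ k = 11 D`. -/
theorem no_twentyfive_eleven (D : ℕ) (k : ℕ → ℕ) (N : ℕ) (hk : ∀ i, i < N → 1 ≤ k i ∧ k i ≤ 11)
    (hsum : ∑ i ∈ range N, k i = 11 * D) : ∑ i ∈ range N, k i * (11 - k i) ≠ 50 := by
  intro hv
  obtain ⟨h1, h2⟩ := counts_eleven k N hk
  rw [h1] at hsum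
  rw [h2] at hv
  exact no_twentyfive_eleven_arith _ _ _ _ _ _ _ _ _ _ _ D hsum hv


end C047

end TriangleCap

end PercRepro
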